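import Summits.AnomalousDissipation.AnomalousDissipation.Statement
import Summits.AnomalousDissipation.AnomalousDissipation.Theorems.SoloInformedFluxFloor
import Literature.Analysis.FluidPDE.LongTimeAverageNonneg
import HarnessLib

/-!
# Solo (informed) — W11c: the structure-function floor at every fixed small scale

The iterated-limit reading of the flux floor `fluxFloor_of_vanishingViscosity` (W11b), made
kernel-level.  With `ω(v; ℓ) = sup_{0<‖y‖≤ℓ} ‖v(· + y) - v‖_{L³}/‖y‖^{1/3}`
(`eLocDiffModulus (1/3) 3`, so `ω(v; ℓ)³ = sup_{0<‖y‖≤ℓ} S₃^{abs}(v; y)/‖y‖`) and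
`Ω(u; ℓ) = limsup_{T→∞} T⁻¹∫₀ᵀ ω(u(t); ℓ)³ dt ∈ [0, ∞]`:

* `structureFloor_of_vanishingViscosity` — there is a constant `C` (the CCFS local flux constant on
  `T³`) such that for every steady smooth divergence-free mean-zero force `f`, every vanishing
  viscosity sequence `ν_j → 0`, every family of global Leray–Hopf solutions with `⟨‖u_j‖₂²⟩ ≤ E`
  and `⟨ν_j‖∇u_j‖₂²⟩ ≥ ε > 0`, and every FIXED scale `0 < ℓ ≤ 1/4` with
  `24·[f]_{B¹_{2,∞}}·(1 + E)·ℓ ≤ ε`:  EVENTUALLY IN `j`,  `ε/2 ≤ C · Ω(u_j; ℓ)`.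
* `anomalousDissipation_imp_structureFloor` — the summit-facing form: a witness of
  `AnomalousDissipation` carries a scale `ℓ₀ > 0` below which, at every fixed scale, the long-time
  mean of the compensated absolute third-order structure function `sup_{‖y‖≤ℓ} S₃^{abs}(y)/‖y‖` is
  eventually (in `j`) at least `ε/(2C)` — in particular it does not tend to zero as `ℓ → 0`
  uniformly in `j` (no uniform `B^{1/3}_{3,c₀}`), and wherever it is finite it exhibits linear (or
  rougher) lower scaling in `‖y‖` down to arbitrarily small fixed scales in the inviscid limit.

As for W11b, the statement is in `[0, ∞]`: it is non-trivial exactly at scales where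
`Ω(u_j; ℓ) < ∞`.  [cite: Eyink2024, §3.1.3 (3.21); CCFS2008, (13)–(18)]
-/

open MeasureTheory Filter Topology Set Function
open scoped ENNReal NNReal

namespace Summit.AnomalousDissipation.AnomalousDissipation.Theorems

open Literature.Analysis Literature.Analysis.FunctionSpaces Literature.Analysis.FluidPDE

/-- **W11c — the structure-function floor at every fixed small scale.** There is `C` such that
along every vanishing-viscosity family of global Leray–Hopf solutions on `T³` with one steady
smooth divergence-free mean-zero force, mean energy `≤ E` and mean dissipation `≥ ε > 0`, at every
fixed scale `0 < ℓ ≤ 1/4` with `24[f]_{B¹_{2,∞}}(1 + E)ℓ ≤ ε`: eventually in `j`,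
`ε/2 ≤ C · limsup_T T⁻¹∫₀ᵀ ω(u_j(t); ℓ)³ dt`. (From W11b with `λ = 1`: the force term is `≤ ε/4`
by the choice of `ℓ`, the viscous term `ν_j(36C₁²/ℓ²)E ≤ ε/4` eventually.) [cite: Eyink2024, §3.1.3] -/
theorem structureFloor_of_vanishingViscosity :
    ∃ C : ℝ≥0, ∀ {f : UnitAddTorus (Fin 3) → EuclideanSpace ℝ (Fin 3)} (_ : Torus.IsSmooth f)
      (_ : Torus.IsDivFree f) (_ : Torus.HasZeroMean f) {ν : ℕ → ℝ}
      {u₀ : ℕ → UnitAddTorus (Fin 3) → EuclideanSpace ℝ (Fin 3)}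
      {u : ℕ → ℝ → UnitAddTorus (Fin 3) → EuclideanSpace ℝ (Fin 3)} {E ε : ℝ}
      (_ : ∀ j, 0 < ν j) (_ : Tendsto ν atTop (𝓝 0))
      (_ : ∀ j, Torus.IsGlobalLerayHopf (ν j) (fun _ => f) (u₀ j) (u j))
      (_ : ∀ j, meanEnergy (u j) ≤ E) (_ : ∀ j, ε ≤ meanDissipation (ν j) (u j)) (_ : 0 < ε)
      {ℓ : ℝ} (_ : 0 < ℓ) (_ : ℓ ≤ 1 / 4)
      (_ : 24 * (eBesovSupSeminorm 1 2 f volume).toReal * (1 + E) * ℓ ≤ ε),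
      ∀ᶠ j in atTop, ENNReal.ofReal (ε / 2) ≤
        C * limsup (fun T => (∫⁻ t in Ioo 0 T, eLocDiffModulus (1 / 3) 3 (u j t) volume ℓ ^ 3) /
          ENNReal.ofReal T) atTop := by
  obtain ⟨C, hC⟩ := fluxFloor_of_vanishingViscosity
  refine ⟨C, ?_⟩
  intro f hf hdiv hmean ν u₀ u E ε hν hν0 hu hE hε hε0 ℓ hℓ hℓ' hsmall
  have hE0 : 0 ≤ E := (meanEnergy_nonneg (u 0)).trans (hE 0)
  have hF0 : 0 ≤ (eBesovSupSeminorm 1 2 f volume).toReal := ENNReal.toReal_nonneg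
  have hε4 : (0 : ℝ) < ε / 4 := by positivity
  have hev : ∀ᶠ j in atTop,
      ν j * (36 * Torus.gradProfileMass (Fin 3) ^ 2 / ℓ ^ 2) * E ≤ ε / 4 := by
    have ht : Tendsto (fun j => ν j * (36 * Torus.gradProfileMass (Fin 3) ^ 2 / ℓ ^ 2) * E)
        atTop (𝓝 0) := by
      simpa using (hν0.mul_const (36 * Torus.gradProfileMass (Fin 3) ^ 2 / ℓ ^ 2)).mul_const E
    exact ht.eventually (ge_mem_nhds hε4)
  filter_upwards [hev] with j hj
  have h := hC hf hdiv hmean hν hu hE hε hℓ hℓ' one_pos j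
  have hrest : ν j * (36 * Torus.gradProfileMass (Fin 3) ^ 2 / ℓ ^ 2) * E +
      6 * (eBesovSupSeminorm 1 2 f volume).toReal * ℓ * (1 + E / 1) ≤ ε / 2 := by
    rw [div_one]
    have h6 : 6 * (eBesovSupSeminorm 1 2 f volume).toReal * ℓ * (1 + E) ≤ ε / 4 := by
      nlinarith [hsmall, mul_nonneg (mul_nonneg hF0 hℓ.le) (by linarith : (0 : ℝ) ≤ 1 + E)]
    linarith
  have h2 : ENNReal.ofReal ε ≤ C * limsup (fun T => (∫⁻ t in Ioo 0 T,
      eLocDiffModulus (1 / 3) 3 (u j t) volume ℓ ^ 3) / ENNReal.ofReal T) atTop +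
      ENNReal.ofReal (ε / 2) :=
    h.trans (add_le_add le_rfl (ENNReal.ofReal_le_ofReal hrest))
  have hsplit : ENNReal.ofReal ε = ENNReal.ofReal (ε / 2) + ENNReal.ofReal (ε / 2) := by
    rw [← ENNReal.ofReal_add (by positivity) (by positivity)]; congr 1; ring
  rw [hsplit] at h2
  exact (ENNReal.add_le_add_iff_right ENNReal.ofReal_ne_top).1 h2

/-- **Summit-facing reading of W11c.** If `AnomalousDissipation` holds, its witness family
`(f, ν_j, u_j, ε)` comes with a constant `C` and a scale `ℓ₀ > 0` such that at every fixed scale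
`0 < ℓ ≤ ℓ₀`, eventually in `j`, `ε/2 ≤ C · limsup_T T⁻¹∫₀ᵀ ω(u_j(t); ℓ)³ dt`: the long-time mean
of the compensated absolute third-order structure function `sup_{‖y‖≤ℓ} S₃^{abs}(u_j; y)/‖y‖` is
bounded below at all small fixed scales, uniformly in the inviscid limit. [cite: Eyink2024, §3.1.3] -/
theorem anomalousDissipation_imp_structureFloor (h : AnomalousDissipation) :
    ∃ (C : ℝ≥0) (f : UnitAddTorus (Fin 3) → EuclideanSpace ℝ (Fin 3)) (ν : ℕ → ℝ)
      (u : ℕ → ℝ → UnitAddTorus (Fin 3) → EuclideanSpace ℝ (Fin 3)) (ε ℓ₀ : ℝ),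
      Torus.IsSmooth f ∧ (∀ j, 0 < ν j) ∧ Tendsto ν atTop (𝓝 0) ∧ 0 < ε ∧
      (∀ j, ε ≤ meanDissipation (ν j) (u j)) ∧ 0 < ℓ₀ ∧
      ∀ ⦃ℓ : ℝ⦄, 0 < ℓ → ℓ ≤ ℓ₀ → ∀ᶠ j in atTop, ENNReal.ofReal (ε / 2) ≤
        C * limsup (fun T => (∫⁻ t in Ioo 0 T, eLocDiffModulus (1 / 3) 3 (u j t) volume ℓ ^ 3) /
          ENNReal.ofReal T) atTop := by
  obtain ⟨f, hf, hdiv, hmean, ν, u₀, u, hν, hν0, hu, ⟨E, hE⟩, ε, hε, hεj⟩ := h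
  obtain ⟨C, hC⟩ := structureFloor_of_vanishingViscosity
  have hE0 : 0 ≤ E := (meanEnergy_nonneg (u 0)).trans (hE 0)
  have hF0 : 0 ≤ (eBesovSupSeminorm 1 2 f volume).toReal := ENNReal.toReal_nonneg
  set A : ℝ := 24 * (eBesovSupSeminorm 1 2 f volume).toReal * (1 + E) with hA
  have hA0 : 0 ≤ A := by rw [hA]; positivity
  refine ⟨C, f, ν, u, ε, min (1 / 4) (ε / (A + 1)), hf, hν, hν0, hε, hεj,
    lt_min (by norm_num) (by positivity), fun ℓ hℓ hℓ₀ => ?_⟩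
  have hℓ4 : ℓ ≤ 1 / 4 := hℓ₀.trans (min_le_left _ _)
  have hℓA : ℓ ≤ ε / (A + 1) := hℓ₀.trans (min_le_right _ _)
  have hsmall : A * ℓ ≤ ε := by
    have h1 : A * ℓ ≤ A * (ε / (A + 1)) := mul_le_mul_of_nonneg_left hℓA hA0
    have h2 : A * (ε / (A + 1)) ≤ ε := by
      rw [mul_div_assoc', div_le_iff₀ (by positivity : (0 : ℝ) < A + 1)]; nlinarith
    exact h1.trans h2
  exact hC hf hdiv hmean hν hν0 hu hE hεj hε hℓ hℓ4 (by rw [hA] at hsmall; exact hsmall)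

end Summit.AnomalousDissipation.AnomalousDissipation.Theorems
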